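import Summits.AtomisticToContinuum.HydrodynamicLimit.Theorems.JParityClosureLocalSecondLawCoarseFieldBounds
import Summits.AtomisticToContinuum.HydrodynamicLimit.Theorems.JParityClosureDensityCapMeanDisplacement
import Summits.AtomisticToContinuum.HydrodynamicLimit.Theorems.JParityClosureKineticEnergyTailsApriori
import HarnessLib

/-!
# History nets for the coarse density (helper for stub T `stub_historyNet` of the line
# `contact-asymmetry-information`, crux `LocalSecondLaw`, stmt-AtomisticToContinuum-13081)

Stub T of the line asks for an `N`-independent finite sup-norm net, on `[0, τ] × 𝕋³`, of the coarse histories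
`s ↦ (ρ_r, m_r, e_r)(Φₛ z)` of all but `δ` of the local-Gibbs mass.  This file proves the DENSITY component, in a form
stronger than asked (the centres themselves are independent of `σ`, `N` and the flow, and no `N₀` is needed):

* `abs_sub_floor_mul_le`, `floor_div_mem_levels` — quantisation of a bounded real to the lattice `q ℤ`;
* `exists_finite_net_lipschitz` — **finite sup-norm nets of Lipschitz space–time fields**: for `τ ≥ 0`, a bound `B`, a
  constant `L ≥ 0` and a resolution `η > 0` there are finitely many centres `c_j : ℝ → 𝕋³ → ℝ` such that every field with
  `|f| ≤ B` and `|f s x − f s' x'| ≤ L (|s − s'| + d(x, x'))` on `[0, τ] × 𝕋³` (minimal-image distance) is within `η` of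
  some `c_j` uniformly on `[0, τ] × 𝕋³` (the covering half of Arzelà–Ascoli, constructively: quantise the values at the
  points of a finite space–time grid, `gridUp_timeNet`, `gridUp_euclidNet`);
* `abs_rhoC_flow_sub_le` — on a good orbit the coarse density is jointly Lipschitz:
  `|ρ_r(Φ_s z)(x) − ρ_r(Φ_{s'} z)(x')| ≤ 3/(πr⁴) (√(2 ke z) |s − s'| + d(x, x'))` (the Lipschitz clock
  `stub_meanDisplacement` + `gridUp_clock`, and `abs_rhoC_sub_le`);
* `rho_historyNet` — **the density-history net**: for continuous profiles `a₀, θ₀ > 0`, `u₀`, every `τ ≥ 0`, `η, δ > 0`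
  and `r > 0` there are `M` centres `c_j` such that for EVERY `σ`, `N` and hard-sphere flow `Φ` the local Gibbs probability
  that the density history `(s, x) ↦ ρ_r(Φₛ z)(x)` is `η`-far (in sup-norm on `[0, τ] × 𝕋³`) from all `c_j` is at most `δ`.
  Inputs: energy conservation and the Gaussian second moment (`exists_lintegral_tailEnergy_flow_le`: `𝔼[(N+1)⁻¹∑|vᵢ|²] ≤ K`),
  Markov's inequality, the null bad set (`gridUp_localGibbsLaw_compl_good`).

What is NOT here (and why): the momentum and energy components of stub T.  `m_r(·, x)` and `e_r(·, x)` jump at collisions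
(by `(N+1)⁻¹ (b_r(xᵢ, x) − b_r(xⱼ, x)) Δvᵢ`, of size `≤ 3ε|Δv|/(πr⁴(N+1))` thanks to momentum/energy conservation), so
their sup-norm modulus in time over a window is the windowed collision activity `(ε/(N+1)) ∑_{coll ∈ window} |Δv|`, and the
free-streaming part of `∂ₛ e_r` is the divergence of the CUBIC energy current; neither is controlled by the conserved energy,
and no window/tail bound under the local Gibbs law along the flow is in the tree (CollisionTightness stmt-13085 is the total
count and is open for non-constant profiles; KineticEnergyTails stmt-13087 is fixed-time and pre-shock).

References: elementary (Arzelà–Ascoli covering numbers); C. Kipnis, C. Landim, *Scaling Limits of Interacting Particle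
Systems* (1999), Ch. 4 (from fixed-time to uniform statements); H. Spohn, *Large Scale Dynamics of Interacting Particles*
(1991), Part I §3 (setting).
-/

noncomputable section

namespace Summit.AtomisticToContinuum.HydrodynamicLimit.Theorems.LocalSecondLawHistoryNet

open scoped BigOperators Topology Classical MeasureTheory ENNReal
open Filter Set MeasureTheory
open Literature.MathematicalPhysics.KineticTheory
open Literature.Analysis.FluidPDE
open Summit.AtomisticToContinuum.HydrodynamicLimit.Theorems.LocalSecondLawNegative
open Summit.AtomisticToContinuum.HydrodynamicLimit.Theorems.LocalSecondLawLedger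

/-! ## Quantisation of bounded reals -/

/-- Quantisation to the lattice `q ℤ` from below: `|y − q ⌊y/q⌋| ≤ q`. -/
theorem abs_sub_floor_mul_le {q : ℝ} (hq : 0 < q) (y : ℝ) : |y - (⌊y / q⌋ : ℝ) * q| ≤ q := by
  have h1 : ((⌊y / q⌋ : ℤ) : ℝ) ≤ y / q := Int.floor_le _
  have h2 : y / q < ((⌊y / q⌋ : ℤ) : ℝ) + 1 := Int.lt_floor_add_one _
  have h1' : ((⌊y / q⌋ : ℤ) : ℝ) * q ≤ y := by rwa [← le_div_iff₀ hq]
  have h2' : y < (((⌊y / q⌋ : ℤ) : ℝ) + 1) * q := by rwa [← div_lt_iff₀ hq]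
  rw [abs_le]
  constructor <;> nlinarith

/-- The quantisation level of a real of modulus `≤ B` lies in the finite window `[-⌈|B|/q⌉₊, ⌈|B|/q⌉₊]`. -/
theorem floor_div_mem_levels {q : ℝ} (hq : 0 < q) {B y : ℝ} (hy : |y| ≤ B) :
    ⌊y / q⌋ ∈ Finset.Icc (-((⌈|B| / q⌉₊ : ℕ) : ℤ)) ((⌈|B| / q⌉₊ : ℕ) : ℤ) := by
  have hB : B ≤ |B| := le_abs_self B
  have hyB : -|B| ≤ y ∧ y ≤ |B| := by
    have := abs_le.1 hy
    constructor <;> linarith [this.1, this.2]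
  have hc : |B| / q ≤ ((⌈|B| / q⌉₊ : ℕ) : ℝ) := Nat.le_ceil _
  rw [Finset.mem_Icc]
  constructor
  · -- lower bound: ⌊y/q⌋ ≥ ⌊-|B|/q⌋ ≥ -⌈|B|/q⌉₊
    have h1 : ⌊(-(|B| / q) : ℝ)⌋ ≤ ⌊y / q⌋ := by
      refine Int.floor_le_floor ?_
      have hre : (-(|B| / q) : ℝ) = (-|B|) / q := by ring
      rw [hre]
      exact div_le_div_of_nonneg_right hyB.1 hq.le
    have h2 : (-((⌈|B| / q⌉₊ : ℕ) : ℤ)) ≤ ⌊(-(|B| / q) : ℝ)⌋ := by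
      rw [Int.le_floor]
      push_cast
      linarith
    exact h2.trans h1
  · have h1 : ⌊y / q⌋ ≤ ⌊|B| / q⌋ := Int.floor_le_floor (div_le_div_of_nonneg_right hyB.2 hq.le)
    have h2 : ⌊|B| / q⌋ ≤ ((⌈|B| / q⌉₊ : ℕ) : ℤ) := by
      have : ((⌊|B| / q⌋ : ℤ) : ℝ) ≤ ((⌈|B| / q⌉₊ : ℕ) : ℤ) := by
        push_cast
        exact (Int.floor_le _).trans hc
      exact_mod_cast this
    exact h1.trans h2

/-! ## Finite sup-norm nets of Lipschitz space–time fields -/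

/-- **Finite sup-norm nets of Lipschitz space–time fields** (the covering half of Arzelà–Ascoli on `[0, τ] × 𝕋³`,
constructive).  For `τ ≥ 0`, a bound `B`, a constant `L ≥ 0` and a resolution `η > 0` there are `M ≥ 1` centres
`c_j : ℝ → 𝕋³ → ℝ` such that every field `f` with `|f s x| ≤ B` and `|f s x − f s' x'| ≤ L (|s − s'| + d(x, x'))` for
`s, s' ∈ [0, τ]` (minimal-image distance `d`) satisfies `|f s x − c_j s x| ≤ η` on `[0, τ] × 𝕋³` for some `j`.  Proof:
time and space nets of mesh `η/(3(L+1))`, values quantised to `(η/3)ℤ` at the grid points; the centres are the piecewise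
constant fields indexed by the finitely many level assignments on the grid. -/
theorem exists_finite_net_lipschitz {τ : ℝ} (hτ : 0 ≤ τ) (B : ℝ) {L : ℝ} (hL : 0 ≤ L) {η : ℝ} (hη : 0 < η) :
    ∃ M : ℕ, 0 < M ∧ ∃ c : Fin M → ℝ → T3 → ℝ, ∀ f : ℝ → T3 → ℝ,
      (∀ s ∈ Icc (0 : ℝ) τ, ∀ x : T3, |f s x| ≤ B) →
      (∀ s ∈ Icc (0 : ℝ) τ, ∀ s' ∈ Icc (0 : ℝ) τ, ∀ x x' : T3,
          |f s x - f s' x'| ≤ L * (|s - s'| + Torus.euclidDist x x')) →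
        ∃ j : Fin M, ∀ s ∈ Icc (0 : ℝ) τ, ∀ x : T3, |f s x - c j s x| ≤ η := by
  -- meshes
  set δ : ℝ := η / (3 * (L + 1)) with hδdef
  have hL1 : 0 < L + 1 := by linarith
  have hδ : 0 < δ := by positivity
  set q : ℝ := η / 3 with hqdef
  have hq : 0 < q := by positivity
  -- finite nets in time and space
  obtain ⟨St, hStsub, hStnet⟩ := gridUp_timeNet τ hδ
  obtain ⟨Sx, hSxnet⟩ := gridUp_euclidNet hδ
  obtain ⟨s₀, hs₀, -⟩ := hStnet 0 ⟨le_rfl, hτ⟩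
  -- levels
  set Kz : ℕ := ⌈|B| / q⌉₊ with hKz
  set Lv : Finset ℤ := Finset.Icc (-(Kz : ℤ)) (Kz : ℤ) with hLv
  have h0Lv : (0 : ℤ) ∈ Lv := by
    rw [hLv, Finset.mem_Icc]; constructor <;> simp
  -- codes: level assignments on the grid
  let G : Type := ↥St × ↥Sx
  let C : Type := G → ↥Lv
  haveI : Fintype C := inferInstance
  haveI : Nonempty C := ⟨fun _ => ⟨0, h0Lv⟩⟩
  set M : ℕ := Fintype.card C with hMdef
  have hM : 0 < M := Fintype.card_pos
  let e : C ≃ Fin M := Fintype.equivFin C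
  -- grid selection
  let selT : ℝ → ↥St := fun s =>
    if h : ∃ s' ∈ St, |s - s'| ≤ δ then ⟨Classical.choose h, (Classical.choose_spec h).1⟩ else ⟨s₀, hs₀⟩
  have hselT : ∀ s ∈ Icc (0 : ℝ) τ, |s - (selT s : ℝ)| ≤ δ := by
    intro s hs
    have h : ∃ s' ∈ St, |s - s'| ≤ δ := hStnet s hs
    simp only [selT, dif_pos h]
    exact (Classical.choose_spec h).2
  let selX : T3 → ↥Sx := fun x => ⟨Classical.choose (hSxnet x), (Classical.choose_spec (hSxnet x)).1⟩
  have hselX : ∀ x : T3, Torus.euclidDist x (selX x : T3) ≤ δ := fun x => (Classical.choose_spec (hSxnet x)).2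
  -- centres
  let centre : C → ℝ → T3 → ℝ := fun φ s x => ((φ (selT s, selX x) : ℤ) : ℝ) * q
  refine ⟨M, hM, fun j => centre (e.symm j), fun f hB hLip => ?_⟩
  -- the code of `f`
  have hmem : ∀ g : G, ⌊f (g.1 : ℝ) (g.2 : T3) / q⌋ ∈ Lv := fun g =>
    floor_div_mem_levels hq (hB _ (hStsub _ g.1.2) _)
  let φf : C := fun g => ⟨⌊f (g.1 : ℝ) (g.2 : T3) / q⌋, hmem g⟩
  refine ⟨e φf, fun s hs x => ?_⟩
  change |f s x - centre (e.symm (e φf)) s x| ≤ η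
  have hcode : centre (e.symm (e φf)) s x = ((⌊f (selT s : ℝ) (selX x : T3) / q⌋ : ℤ) : ℝ) * q := by
    simp only [centre, Equiv.symm_apply_apply, φf]
  rw [hcode]
  -- the grid point of (s, x)
  have hs' : ((selT s : ℝ)) ∈ Icc (0 : ℝ) τ := hStsub _ (selT s).2
  have h1 : |f s x - f (selT s : ℝ) (selX x : T3)| ≤ L * (δ + δ) := by
    refine (hLip s hs _ hs' x _).trans ?_
    exact mul_le_mul_of_nonneg_left (add_le_add (hselT s hs) (hselX x)) hL
  have h2 : |f (selT s : ℝ) (selX x : T3) - ((⌊f (selT s : ℝ) (selX x : T3) / q⌋ : ℤ) : ℝ) * q| ≤ q :=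
    abs_sub_floor_mul_le hq _
  have h3 : L * (δ + δ) ≤ 2 * (η / 3) := by
    rw [hδdef]
    have : L * (η / (3 * (L + 1)) + η / (3 * (L + 1))) = 2 * (η / 3) * (L / (L + 1)) := by
      field_simp
      ring
    rw [this]
    have hfrac : L / (L + 1) ≤ 1 := by
      rw [div_le_one hL1]; linarith
    have h23 : 0 ≤ 2 * (η / 3) := by positivity
    nlinarith
  calc |f s x - ((⌊f (selT s : ℝ) (selX x : T3) / q⌋ : ℤ) : ℝ) * q|
      ≤ |f s x - f (selT s : ℝ) (selX x : T3)| +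
          |f (selT s : ℝ) (selX x : T3) - ((⌊f (selT s : ℝ) (selX x : T3) / q⌋ : ℤ) : ℝ) * q| :=
        abs_sub_le _ _ _
    _ ≤ 2 * (η / 3) + η / 3 := add_le_add (h1.trans h3) (by rw [hqdef] at h2; exact h2)
    _ = η := by ring

/-! ## The coarse density along a good orbit is jointly Lipschitz -/

variable {N : ℕ}

/-- `2 · ((N+1)⁻¹ · configEnergy w) = (N+1)⁻¹ ∑ᵢ ‖vᵢ‖²` (twice the mean kinetic energy per particle; the right-hand
side is the functional of `exists_lintegral_tailEnergy_flow_le` at cut-off `-1`). -/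
theorem two_mul_meanEnergy_eq (w : Phase N) :
    2 * ((((N + 1 : ℕ) : ℝ))⁻¹ * configEnergy w) = ((N : ℝ) + 1)⁻¹ * ∑ i, ‖(w i).2‖ ^ 2 := by
  unfold configEnergy
  push_cast
  ring

/-- **Joint Lipschitz bound of the coarse density along a good orbit**: for `z` in the good set of a hard-sphere flow
`Φ` on `𝕋³` and all real times `s, s'` and centres `x, x'`,
`|ρ_r(Φ_s z)(x) − ρ_r(Φ_{s'} z)(x')| ≤ 3/(πr⁴) · (√(2 (N+1)⁻¹ E(z)) · |s − s'| + d(x, x'))`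
(the Lipschitz clock of `DensityCap` — mean displacement `≤` quadratic-mean speed `×` time, conserved energy — in time,
and the kernel's Lipschitz bound in the centre). -/
theorem abs_rhoC_flow_sub_le {r : ℝ} (hr : 0 < r) {σ : ℝ} (Φ : Flow σ N) {z : Phase N} (hz : z ∈ Φ.good)
    (s s' : ℝ) (x x' : T3) :
    |rhoC r (Φ.flow s z) x - rhoC r (Φ.flow s' z) x'| ≤
      3 / (Real.pi * r ^ 4) *
        (Real.sqrt (2 * ((((N + 1 : ℕ) : ℝ))⁻¹ * configEnergy z)) * |s - s'| + Torus.euclidDist x x') := by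
  have hclock : |rhoC r (Φ.flow s z) x - rhoC r (Φ.flow s' z) x| ≤
      3 / (Real.pi * r ^ 4) * Real.sqrt (2 * ((((N + 1 : ℕ) : ℝ))⁻¹ * configEnergy z)) * |s - s'| := by
    have h := gridUp_clock hr Φ (z := z) (fun t t' => stub_meanDisplacement Φ hz t t') s' s x
    -- `mollDensity = rhoC` definitionally
    exact h
  have hcentre : |rhoC r (Φ.flow s' z) x - rhoC r (Φ.flow s' z) x'| ≤ 3 / (Real.pi * r ^ 4) * Torus.euclidDist x x' :=
    abs_rhoC_sub_le hr _ x x'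
  calc |rhoC r (Φ.flow s z) x - rhoC r (Φ.flow s' z) x'|
      ≤ |rhoC r (Φ.flow s z) x - rhoC r (Φ.flow s' z) x| + |rhoC r (Φ.flow s' z) x - rhoC r (Φ.flow s' z) x'| :=
        abs_sub_le _ _ _
    _ ≤ 3 / (Real.pi * r ^ 4) * Real.sqrt (2 * ((((N + 1 : ℕ) : ℝ))⁻¹ * configEnergy z)) * |s - s'| +
          3 / (Real.pi * r ^ 4) * Torus.euclidDist x x' := add_le_add hclock hcentre
    _ = _ := by ring

/-! ## The density-history net under the local Gibbs law -/

/-- **The density-history net** (the `ρ_r`-component of stub T `stub_historyNet`, in a stronger, `N`-uniform form).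
For continuous profiles `a₀ > 0`, `θ₀ > 0`, `u₀`, every horizon `τ ≥ 0`, resolution `η > 0`, tolerance `δ > 0` and
radius `r > 0` there are `M ≥ 1` centres `c_j : ℝ → 𝕋³ → ℝ` such that for EVERY reduced diameter `σ`, particle number
`N` and hard-sphere flow `Φ`, the local Gibbs probability that the coarse density history `(s, x) ↦ ρ_r(Φₛ z)(x)` is not
within `η` of some `c_j` uniformly on `[0, τ] × 𝕋³` is at most `δ`.  Proof: `𝔼[(N+1)⁻¹∑|vᵢ|²] ≤ K` uniformly
(`exists_lintegral_tailEnergy_flow_le`), Markov at the level `K/δ`, the joint Lipschitz bound `abs_rhoC_flow_sub_le` on the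
good set (null complement) below that level, `0 ≤ ρ_r ≤ 3/(πr³)`, and `exists_finite_net_lipschitz`. -/
theorem rho_historyNet :
  ∀ {a₀ θ₀ : T3 → ℝ} {u₀ : T3 → V3}, Continuous a₀ → Continuous θ₀ → Continuous u₀ → (∀ x, 0 < a₀ x) →
    (∀ x, 0 < θ₀ x) → ∀ {τ : ℝ}, 0 ≤ τ → ∀ {η δ : ℝ}, 0 < η → 0 < δ → ∀ {r : ℝ}, 0 < r →
    ∃ M : ℕ, 0 < M ∧ ∃ c : Fin M → ℝ → T3 → ℝ, ∀ (σ : ℝ) (N : ℕ) (Φ : Flow σ N),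
      localGibbsLaw σ a₀ u₀ θ₀ N Φ
          {z | ∀ j : Fin M, ¬ ∀ s ∈ Set.Icc (0 : ℝ) τ, ∀ x : T3, |rhoC r (Φ.flow s z) x - c j s x| ≤ η} ≤
        ENNReal.ofReal δ := by
  intro a₀ θ₀ u₀ ha hθ hu ha0 hθ0 τ hτ η δ hη hδ r hr
  -- the uniform energy bound
  obtain ⟨K, hK⟩ := exists_lintegral_tailEnergy_flow_le (a₀ := a₀) (θ₀ := θ₀) (u₀ := u₀) ha hθ hu
    (fun x => (ha0 x).le) hθ0
  set K' : ℝ := max K 1 with hK'def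
  have hK'pos : 0 < K' := lt_of_lt_of_le one_pos (le_max_right _ _)
  set Kbar : ℝ := K' / δ with hKbardef
  have hKbar : 0 < Kbar := by positivity
  -- the Lipschitz class below the energy level
  set L : ℝ := 3 / (Real.pi * r ^ 4) * (Real.sqrt Kbar + 1) with hLdef
  have hC4 : 0 ≤ 3 / (Real.pi * r ^ 4) := by positivity
  have hL : 0 ≤ L := by positivity
  set B : ℝ := 3 / (Real.pi * r ^ 3) with hBdef
  obtain ⟨M, hM, c, hc⟩ := exists_finite_net_lipschitz hτ B hL hη
  refine ⟨M, hM, c, fun σ N Φ => ?_⟩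
  set P : Measure (Phase N) := localGibbsLaw σ a₀ u₀ θ₀ N Φ with hPdef
  -- twice the mean kinetic energy per particle
  let E : Phase N → ℝ := fun z => ((N : ℝ) + 1)⁻¹ * ∑ i, ‖(z i).2‖ ^ 2
  -- (1) the histories of good, low-energy configurations are pinned
  have hsub : {z | ∀ j : Fin M, ¬ ∀ s ∈ Icc (0 : ℝ) τ, ∀ x : T3, |rhoC r (Φ.flow s z) x - c j s x| ≤ η} ⊆
      Φ.goodᶜ ∪ {z | Kbar ≤ E z} := by
    intro z hz
    by_contra hcon
    simp only [Set.mem_union, Set.mem_compl_iff, Set.mem_setOf_eq, not_or, not_not, not_le] at hcon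
    obtain ⟨hgood, hEz⟩ := hcon
    have hB' : ∀ s ∈ Icc (0 : ℝ) τ, ∀ x : T3, |rhoC r (Φ.flow s z) x| ≤ B := by
      intro s _ x
      rw [abs_of_nonneg (rhoC_nonneg hr _ _)]
      exact rhoC_le_const hr _ _
    have hsqrt : Real.sqrt (2 * ((((N + 1 : ℕ) : ℝ))⁻¹ * configEnergy z)) ≤ Real.sqrt Kbar := by
      refine Real.sqrt_le_sqrt ?_
      rw [two_mul_meanEnergy_eq]
      exact hEz.le
    have hLip' : ∀ s ∈ Icc (0 : ℝ) τ, ∀ s' ∈ Icc (0 : ℝ) τ, ∀ x x' : T3,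
        |rhoC r (Φ.flow s z) x - rhoC r (Φ.flow s' z) x'| ≤ L * (|s - s'| + Torus.euclidDist x x') := by
      intro s _ s' _ x x'
      refine (abs_rhoC_flow_sub_le hr Φ hgood s s' x x').trans ?_
      have hd : 0 ≤ Torus.euclidDist x x' := by rw [Torus.euclidDist_eq]; exact norm_nonneg _
      have habs : 0 ≤ |s - s'| := abs_nonneg _
      have hs1 : 0 ≤ Real.sqrt Kbar := Real.sqrt_nonneg _
      rw [hLdef]
      calc 3 / (Real.pi * r ^ 4) *
            (Real.sqrt (2 * ((((N + 1 : ℕ) : ℝ))⁻¹ * configEnergy z)) * |s - s'| + Torus.euclidDist x x')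
          ≤ 3 / (Real.pi * r ^ 4) * (Real.sqrt Kbar * |s - s'| + Torus.euclidDist x x') := by
            gcongr
        _ ≤ 3 / (Real.pi * r ^ 4) * ((Real.sqrt Kbar + 1) * (|s - s'| + Torus.euclidDist x x')) := by
            refine mul_le_mul_of_nonneg_left ?_ hC4
            nlinarith
        _ = 3 / (Real.pi * r ^ 4) * (Real.sqrt Kbar + 1) * (|s - s'| + Torus.euclidDist x x') := by ring
    obtain ⟨j, hj⟩ := hc (fun s x => rhoC r (Φ.flow s z) x) hB' hLip'
    exact hz j hj
  -- (2) the bad set is null and the high-energy set is small (Markov)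
  have hgood0 : P Φ.goodᶜ = 0 := gridUp_localGibbsLaw_compl_good σ a₀ θ₀ u₀ N Φ
  have hEmeas : Measurable fun z : Phase N => ENNReal.ofReal (E z) := by
    refine (measurable_const.mul (Finset.measurable_sum _ fun i _ => ?_)).ennreal_ofReal
    exact ((measurable_pi_apply i).snd.norm).pow_const 2
  have hint : ∫⁻ z, ENNReal.ofReal (E z) ∂P ≤ ENNReal.ofReal K' := by
    have h := hK σ N Φ (-1) 0
    have hae : (fun z : Phase N => ENNReal.ofReal (((N : ℝ) + 1)⁻¹ * ∑ i : Fin (N + 1),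
        Set.indicator {v : V3 | -1 < ‖v‖} (fun v => ‖v‖ ^ 2) ((Φ.flow 0 z i).2))) =ᵐ[P]
        fun z => ENNReal.ofReal (E z) := by
      have hg : ∀ᵐ z ∂P, z ∈ Φ.good := by
        rw [ae_iff]
        simpa only [Set.compl_def] using hgood0
      filter_upwards [hg] with z hz
      have hind : ∀ v : V3, Set.indicator {v : V3 | -1 < ‖v‖} (fun v => ‖v‖ ^ 2) v = ‖v‖ ^ 2 := by
        intro v
        exact Set.indicator_of_mem (show v ∈ {v : V3 | -1 < ‖v‖} by
          simp only [Set.mem_setOf_eq]; linarith [norm_nonneg v]) _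
      simp only [hind, Φ.flow_zero z hz, E]
    rw [← lintegral_congr_ae hae]
    exact h.trans (ENNReal.ofReal_le_ofReal (le_max_left _ _))
  have hmarkov : P {z | Kbar ≤ E z} ≤ ENNReal.ofReal δ := by
    have hsubE : {z : Phase N | Kbar ≤ E z} ⊆ {z | ENNReal.ofReal Kbar ≤ ENNReal.ofReal (E z)} :=
      fun z hz => ENNReal.ofReal_le_ofReal hz
    have hne : ENNReal.ofReal Kbar ≠ 0 := (ENNReal.ofReal_pos.2 hKbar).ne'
    calc P {z | Kbar ≤ E z} ≤ P {z | ENNReal.ofReal Kbar ≤ ENNReal.ofReal (E z)} := measure_mono hsubE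
      _ ≤ (∫⁻ z, ENNReal.ofReal (E z) ∂P) / ENNReal.ofReal Kbar :=
          meas_ge_le_lintegral_div hEmeas.aemeasurable hne ENNReal.ofReal_ne_top
      _ ≤ ENNReal.ofReal K' / ENNReal.ofReal Kbar := by gcongr
      _ = ENNReal.ofReal (K' / Kbar) := (ENNReal.ofReal_div_of_pos hKbar).symm
      _ = ENNReal.ofReal δ := by
          congr 1
          rw [hKbardef]
          field_simp
  -- (3) conclusion
  calc P {z | ∀ j : Fin M, ¬ ∀ s ∈ Icc (0 : ℝ) τ, ∀ x : T3, |rhoC r (Φ.flow s z) x - c j s x| ≤ η}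
      ≤ P (Φ.goodᶜ ∪ {z | Kbar ≤ E z}) := measure_mono hsub
    _ ≤ P Φ.goodᶜ + P {z | Kbar ≤ E z} := measure_union_le _ _
    _ ≤ 0 + ENNReal.ofReal δ := add_le_add hgood0.le hmarkov
    _ = ENNReal.ofReal δ := zero_add _

end Summit.AtomisticToContinuum.HydrodynamicLimit.Theorems.LocalSecondLawHistoryNet

end
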